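import Mathlib.Analysis.Matrix.Normed
import Mathlib.Analysis.Complex.Basic
import Literature.MathematicalPhysics.QuantumFieldTheory.Volkov2020.AppendixDiracNumerators
import Literature.MathematicalPhysics.QuantumFieldTheory.Volkov2020.ProjectorVanishingLemma
import HarnessLib

/-!
# Volkov 2020 (NPB 961, 115232) §2.1: **THE DIRAC-MATRIX MODEL** of the abstract Clifford algebra of B.37/B.39/B.47 — «the Dirac gamma matrices γ_μ satisfy γ^μγ^ν + γ^νγ^μ = 2g^{μν}» holds for the standard 4×4 Dirac representation in M₄(ℂ) (PROVED, sixteen matrix identities); M₄(ℂ) with the ℓ∞-operator norm is a real normed algebra with ‖1‖ = 1 (the hypothesis classes `NormedRing`, `NormedAlgebra ℝ`, `NormOneClass` of B.47 are met by the physical model); and at the printed evaluation point of the projector, q = 0 (p₁ = p₂ = p, p² = m², rest frame), the printed spinor conditions «(p̂ − m)ψ₁ = ψ̄₂(p̂ − m) = 0» have the nonzero solutions ψ₁ = ψ̄₂ = e₀, the functional X ↦ Re(ψ̄₂Xψ₁) is ℝ-linear, vanishes on U(p̂ − m) and on (p̂ − m)V (B.37's on-shell relation ≈ is therefore NON-TRIVIAL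 in the model: 1 ≉ 0), vanishes on γ_k (k = 1, 2, 3) and is bounded with constant N = 1 — a nonzero admissible «𝒫» in the sense of B.47's `abs_projector_le`

independent recomputation; certified where stated, statistical where stated; no new-physics claim.

CITATION HEADER (venture `QEDPrecision`, cell `pub-qed`, track TROPICAL seat V3b = `pub-qed-trop-v3-lit-2` gen 12; VALUE-FREE: identities and
inequalities for explicit 4×4 complex matrices — nothing of X352, nothing per word). NON-VACUITY COMPANION of `Volkov2020.AppendixDiracNumerators`
(B.37: `IsDirac`, `sl`, `dot`, `OnShellEq`, whose own non-vacuity witness `isDirac_cliffordAlgebra` is Mathlib's abstract Clifford algebra, which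
carries no norm) and of `Volkov2020.ProjectorVanishingLemma` r2/r3 (B.39/B.47/B.48: Lemma 3.8, Lemma 3.9 modulo 𝒫 in a NORMED Clifford algebra, for
every admissible bounded functional 𝒫) — the latter was NOT imported in r1 (its farm olean was unbuilt at filing; the application of
`ProjectorVanishing.abs_projector_le` to the objects below was left as a one-screen successor append = r2's §4). Serves §B.49 of `tropical/view/V3-VOLKOV-DEGREES.md`.
r2 (gen 13, 2026-08-25; additions only — every r1 declaration unchanged): `Volkov2020.ProjectorVanishingLemma` (r3) is now IMPORTED and §4
closes the pipeline in the model: `modelCtx` (γ = the Dirac matrices, p₁ = p₂ = the rest-frame momentum, μ = k) and **`model_abs_projector_le`** =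
B.47's `ProjectorVanishing.abs_projector_le` instantiated on the one-photon-exchange numerator shape γ^ν(m + Q̂′₂)γ_k(m + Q̂′₁)γ_ν with 𝒫 := `entryRe`
(N = 1): |entryRe X| ≤ 1·(assemblyConst·B) — every hypothesis of B.47 discharged by §1–§3 of this file. Serves §B.53 of the view file.

Source. [Volkov2020] S. Volkov, "Infrared and ultraviolet power counting on the mass shell in quantum electrodynamics", Nucl. Phys. B 961
(2020) 115232 = arXiv:1912.04885v4 (e-print tex `iclos_arxiv.tex`, sha256 8613757ca2360833…, held by the cell under
`pub-qed-trop-v3-lit-2/sources/arxiv-1912.04885/`; numbering by section = the journal's), VERBATIM: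
* §2.1 (journal p.6; tex l.129): "We use the metric g_{μν}, where g₀₀ = 1, g₁₁ = g₂₂ = g₃₃ = −1, the Dirac gamma matrices γ_μ satisfy
  γ^μγ^ν + γ^νγ^μ = 2g^{μν}."
* §2.1 (journal p.6; tex l.133–139): "The Feynman amplitude Γ(p,q) can be expressed in terms of three form-factors:
  ψ̄₂Γ_μ(p,q)ψ₁ = ψ̄₂(f(q²)γ_μ − (1/2m)g(q²)σ_{μν}q^ν + h(q²)q_μ)ψ₁, where (p̂ − q̂/2 − m)ψ₁ = ψ̄₂(p̂ + q̂/2 − m) = 0".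
* §2.2.2 (journal p.9; tex l.259): "𝒫[Γ(p,q)] is determined by Γ(p,q) at {p² = m², q = 0} and its derivatives at these points";
  (tex l.271–273): "these terms are eliminated by the magnetic moment projector, because 𝒫γ_μ = 0."
* proof of Lemma 3.8, first sentence (journal p.15; tex l.497): "in the definition of 𝒫 we consider only expressions of the form ψ̄₂Γ(p₁,p₂)ψ₁,
  where (m − p̂₁)ψ₁ = 0, ψ̄₂(m − p̂₂) = 0, p₁² = p₂² = m²."

READING / MODELLING (flagged). The source prints no representation of the γ's; the standard Dirac representation γ⁰ = diag(1, 1, −1, −1),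
γ^k = ((0, σ_k), (−σ_k, 0)) (Pauli matrices σ_k) is used [folklore: Bjorken–Drell, App. A] (the tree's `Literature.QLatticeAQFT.euclideanGamma`
of `QuantumLattice.GrassmannIntegral` is the EUCLIDEAN chiral family {γ_μ, γ_ν} = 2δ_{μν} — another signature, behind lattice-QFT imports — hence
not reused; nothing of it is re-declared), with LOWER-index numerical relation
γ_μγ_ν + γ_νγ_μ = 2g_{μν}·1 as in B.37's `IsDirac` (g = `η` = diag(1, −1, −1, −1)). M₄(ℂ) is an ℝ-algebra through ℂ (`Matrix.instAlgebra`); its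
norm is Mathlib's ℓ∞-operator norm ‖X‖ = max_i Σ_j |X_{ij}| (`Matrix.linftyOpNormedRing`, `Matrix.linftyOpNormedAlgebra`, LOCAL instances as in
Mathlib — submultiplicative, ‖1‖ = 1). The evaluation point is the printed {p² = m², q = 0}, i.e. p₁ = p₂ = p, taken in the rest frame
p = (m, 0, 0, 0) (`restMomentum m`; any m : ℝ); there p̂ = m·γ⁰ and p̂ − m = m(γ⁰ − 1) = diag(0, 0, −2m, −2m), so ψ₁ = e₀ solves (p̂ − m)ψ₁ = 0 and
the row vector ψ̄₂ = e₀ solves ψ̄₂(p̂ − m) = 0; «ψ̄₂Γψ₁» is then the (0,0) entry of Γ, and `entryRe` := X ↦ Re X₀₀ is the real part of that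
pairing. Nothing is claimed about the form-factor functional 𝒫 itself (uniqueness of (f, g, h) is not modelled, as in B.37/B.39/B.47): `entryRe`
is ONE nonzero functional with every property B.47's `abs_projector_le` asks of 𝒫 (for a spatial index μ = k).

WHAT THE KERNEL CERTIFIES (all PROVED; Mathlib + B.37 only; no named fact, D-0026 net debt 0):
* §1 `γ0`, `γ1`, `γ2`, `γ3`, `diracGamma`; **`isDirac_diracGamma : IsDirac diracGamma`** (the sixteen identities γ_μγ_ν + γ_νγ_μ = 2g_{μν}·1,
  by `norm_num` on the explicit matrices); hence B.37's whole calculus holds for the Dirac matrices — recorded instances `dirac_sl_sq`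
  (p̂p̂ = p²·1), `dirac_gamma_sl` (γ_ξp̂ + p̂γ_ξ = 2p_ξ), `dirac_F23` (the Appendix's «computer» reduction of F₂₃, B.37's `F23_eq`, for the actual Dirac matrices).
* §2 under the local ℓ∞-operator-norm instances: `diracNormedRing`, `diracNormedAlgebra` (named, for `letI`), `dirac_norm_one` (‖1‖ = 1),
  `dirac_normOneClass`, `dirac_nontrivial`, **`norm_entry_le`** (|X_{ij}| ≤ ‖X‖).
* §3 `restMomentum`, `dot_restMomentum` (p² = m²), `sl_restMomentum` (p̂ = m·γ⁰); the spinors: **`spinor_cond₁`** (p̂ − m)e₀ = 0 and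
  **`spinor_cond₂`** e₀(p̂ − m) = 0 (row); `entryRe` (X ↦ Re X₀₀, ℝ-linear); **`entryRe_kill_right`** (∀ U, entryRe(U(p̂ − m)) = 0),
  **`entryRe_kill_left`** (∀ V, entryRe((p̂ − m)V) = 0), **`entryRe_gamma_spatial`** (entryRe γ_k = 0, k = 1, 2, 3), **`abs_entryRe_le`**
  (|entryRe X| ≤ 1·‖X‖), `entryRe_one` (= 1); **`not_onShellEq_one_zero`**: ¬ (1 ≈ 0) for B.37's `OnShellEq diracGamma m p p` — the on-shell
  relation of B.37/B.39/B.47 is a non-trivial relation in the physical model, at every m.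
NOT claimed: the paper's projector 𝒫 as a functional (its trace formula is only referred to [Kinoshita] in §2.2.2), form-factor uniqueness, any
other representation or frame (a boost would transport §3 to any on-shell p; not done), anything per word of the cell; nothing of X352.
-/

namespace Literature.MathematicalPhysics.QuantumFieldTheory.Volkov2020

namespace DiracModel

open AppendixNumerators Matrix Complex

/-! ## §1 The Dirac representation satisfies «γ^μγ^ν + γ^νγ^μ = 2g^{μν}» -/

/-- γ⁰ = diag(1, 1, −1, −1). [folklore] -/
def γ0 : Matrix (Fin 4) (Fin 4) ℂ := !![1, 0, 0, 0; 0, 1, 0, 0; 0, 0, -1, 0; 0, 0, 0, -1]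

/-- γ¹ = ((0, σ₁), (−σ₁, 0)). [folklore] -/
def γ1 : Matrix (Fin 4) (Fin 4) ℂ := !![0, 0, 0, 1; 0, 0, 1, 0; 0, -1, 0, 0; -1, 0, 0, 0]

/-- γ² = ((0, σ₂), (−σ₂, 0)). [folklore] -/
def γ2 : Matrix (Fin 4) (Fin 4) ℂ := !![0, 0, 0, -I; 0, 0, I, 0; 0, I, 0, 0; -I, 0, 0, 0]

/-- γ³ = ((0, σ₃), (−σ₃, 0)). [folklore] -/
def γ3 : Matrix (Fin 4) (Fin 4) ℂ := !![0, 0, 1, 0; 0, 0, 0, -1; -1, 0, 0, 0; 0, 1, 0, 0]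

/-- The Dirac family (γ₀, γ₁, γ₂, γ₃) in M₄(ℂ). [folklore] -/
def diracGamma : Fin 4 → Matrix (Fin 4) (Fin 4) ℂ := ![γ0, γ1, γ2, γ3]

/-- The zero 4×4 matrix in `!![…]` form. [folklore] -/
private theorem zero_fin_four : (0 : Matrix (Fin 4) (Fin 4) ℂ) = !![0, 0, 0, 0; 0, 0, 0, 0; 0, 0, 0, 0; 0, 0, 0, 0] := by
  ext i j; fin_cases i <;> fin_cases j <;> rfl

/-- A real multiple of the identity in `!![…]` form. [folklore] -/
private theorem real_smul_one_eq (r : ℝ) : (r • (1 : Matrix (Fin 4) (Fin 4) ℂ)) =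
    !![(r : ℂ), 0, 0, 0; 0, (r : ℂ), 0, 0; 0, 0, (r : ℂ), 0; 0, 0, 0, (r : ℂ)] := by
  ext i j
  fin_cases i <;> fin_cases j <;> simp [Complex.real_smul]

/-- **«The Dirac gamma matrices γ_μ satisfy γ^μγ^ν + γ^νγ^μ = 2g^{μν}»** — the standard Dirac representation is an `IsDirac` family (B.37's
lower-index form γ_μγ_ν + γ_νγ_μ = 2g_{μν}·1, g = diag(1, −1, −1, −1)); sixteen 4×4 identities over ℂ.
[cite: Volkov2020, §2.1 (journal p.6; arXiv:1912.04885v4 tex l.129)] -/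
theorem isDirac_diracGamma : IsDirac diracGamma := by
  intro μ ν
  fin_cases μ <;> fin_cases ν <;>
    simp only [Fin.reduceFinMk, Fin.isValue, Fin.reduceEq, ↓reduceIte, η, real_smul_one_eq, zero_fin_four, diracGamma,
      Matrix.cons_val_zero, Matrix.cons_val_one, Matrix.cons_val_two, Matrix.cons_val_three, Matrix.head_cons,
      Matrix.tail_cons] <;>
    norm_num [γ0, γ1, γ2, γ3]

/-- B.37's p̂p̂ = p²·1 for the Dirac matrices. [cite: Volkov2020, §2.1 (journal p.6; arXiv:1912.04885v4 tex l.129)] -/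
theorem dirac_sl_sq (p : Fin 4 → ℝ) : sl diracGamma p * sl diracGamma p = dot p p • (1 : Matrix (Fin 4) (Fin 4) ℂ) :=
  sl_sq isDirac_diracGamma p

/-- B.37's γ_ξp̂ + p̂γ_ξ = 2p_ξ·1 for the Dirac matrices. [cite: Volkov2020, proof of Lemma 3.8 «γ_{ξ}(m+p̂₂) = (m−p̂₂)γ_{ξ} + 2p_{2ξ}» (journal p.15; arXiv:1912.04885v4 tex l.501)] -/
theorem dirac_gamma_sl (p : Fin 4 → ℝ) (ξ : Fin 4) :
    diracGamma ξ * sl diracGamma p + sl diracGamma p * diracGamma ξ = (2 * lo p ξ) • (1 : Matrix (Fin 4) (Fin 4) ℂ) :=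
  gamma_sl isDirac_diracGamma p ξ

/-- The Appendix's «The calculation with the help of a computer gives F₂₃ = 8mγ_μp̂₁ + 8mp̂₂γ_μ − 16mp_{2μ} − 16mp_{1μ} + 16(p₁p₂)γ_μ − 8m²γ_μ»
holds for the actual Dirac matrices (B.37's `F23_eq` instantiated). [cite: Volkov2020, Appendix (journal p.19; arXiv:1912.04885v4 tex l.659, l.670)] -/
theorem dirac_F23 (m : ℝ) (p₁ p₂ : Fin 4 → ℝ) (μ : Fin 4) :
    F23 diracGamma m p₁ p₂ μ = (8 * m) • (diracGamma μ * sl diracGamma p₁) + (8 * m) • (sl diracGamma p₂ * diracGamma μ)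
      - (16 * m * lo p₂ μ) • (1 : Matrix (Fin 4) (Fin 4) ℂ) - (16 * m * lo p₁ μ) • (1 : Matrix (Fin 4) (Fin 4) ℂ)
      + (16 * dot p₁ p₂) • diracGamma μ - (8 * m ^ 2) • diracGamma μ :=
  F23_eq isDirac_diracGamma m p₁ p₂ μ

/-! ## §2 M₄(ℂ) as a real normed algebra with ‖1‖ = 1 (the hypothesis classes of B.47) -/

section Normed

-- Mathlib deliberately keeps the matrix norms non-global («several natural choices»); the ℓ∞-operator norm is switched on SECTION-LOCALLY here,
-- exactly as `Mathlib.Analysis.Matrix.Normed` documents (`attribute [local instance]`), and nothing leaks out of this section.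
attribute [local instance] Matrix.linftyOpNormedRing Matrix.linftyOpNormedAlgebra

/-- M₄(ℂ) with the ℓ∞-operator norm is a `NormedRing` (named for `letI`). [folklore] -/
@[reducible] noncomputable def diracNormedRing : NormedRing (Matrix (Fin 4) (Fin 4) ℂ) := Matrix.linftyOpNormedRing

/-- … and a `NormedAlgebra ℝ`. [folklore] -/
@[reducible] noncomputable def diracNormedAlgebra : NormedAlgebra ℝ (Matrix (Fin 4) (Fin 4) ℂ) := Matrix.linftyOpNormedAlgebra

/-- ‖1‖ = 1 in M₄(ℂ). [cite: Volkov2020, §2.1 (journal p.6; arXiv:1912.04885v4 tex l.129) — the model of the γ-algebra] -/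
theorem dirac_norm_one : ‖(1 : Matrix (Fin 4) (Fin 4) ℂ)‖ = 1 := norm_one

/-- The class `NormOneClass` holds. [cite: Volkov2020, §2.1 (journal p.6; arXiv:1912.04885v4 tex l.129)] -/
theorem dirac_normOneClass : NormOneClass (Matrix (Fin 4) (Fin 4) ℂ) := inferInstance

/-- M₄(ℂ) is non-trivial (1 ≠ 0). [cite: Volkov2020, §2.1 (journal p.6; arXiv:1912.04885v4 tex l.129)] -/
theorem dirac_nontrivial : Nontrivial (Matrix (Fin 4) (Fin 4) ℂ) := inferInstance

/-- **Every entry is bounded by the norm**: |X_{ij}| ≤ ‖X‖ = max_i Σ_j |X_{ij}|. [folklore] -/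
private theorem nnnorm_entry_le (X : Matrix (Fin 4) (Fin 4) ℂ) (i j : Fin 4) : ‖X i j‖₊ ≤ ‖X‖₊ := by
  rw [Matrix.linfty_opNNNorm_def]
  exact (Finset.single_le_sum (f := fun j => ‖X i j‖₊) (fun _ _ => zero_le) (Finset.mem_univ j)).trans
    (Finset.le_sup (f := fun i => ∑ j, ‖X i j‖₊) (Finset.mem_univ i))

/-- |X_{ij}| ≤ ‖X‖ (real form). [cite: Volkov2020, §2.1 (journal p.6; arXiv:1912.04885v4 tex l.129) — the model's norm] -/
theorem norm_entry_le (X : Matrix (Fin 4) (Fin 4) ℂ) (i j : Fin 4) : ‖X i j‖ ≤ ‖X‖ := by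
  have h := nnnorm_entry_le X i j
  exact_mod_cast h

/-! ## §3 The printed point q = 0: spinors, and a nonzero admissible bounded functional killing γ_k -/

/-- The rest-frame momentum p = (m, 0, 0, 0) (the printed evaluation point {p² = m², q = 0}: p₁ = p₂ = p).
[cite: Volkov2020, §2.2.2 «𝒫[Γ(p,q)] is determined by Γ(p,q) at {p² = m², q = 0} …» (journal p.9; arXiv:1912.04885v4 tex l.259)] -/
def restMomentum (m : ℝ) : Fin 4 → ℝ := fun μ => if μ = 0 then m else 0

/-- p² = m² at the rest-frame point. [cite: Volkov2020, §2.1 «p₁² = p₂² = m²» (journal p.15; arXiv:1912.04885v4 tex l.497)] -/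
theorem dot_restMomentum (m : ℝ) : dot (restMomentum m) (restMomentum m) = m ^ 2 := by
  simp [dot, restMomentum, η, _root_.sq]

/-- p̂ = m·γ⁰ at the rest-frame point. [cite: Volkov2020, §2.1 «p̂» (journal p.6; arXiv:1912.04885v4 tex l.129–139)] -/
theorem sl_restMomentum (m : ℝ) : sl diracGamma (restMomentum m) = m • γ0 := by
  simp [sl, restMomentum, diracGamma]

/-- p̂ − m in `!![…]` form: diag(0, 0, −2m, −2m). [folklore] -/
private theorem sl_sub_eq (m : ℝ) : sl diracGamma (restMomentum m) - m • (1 : Matrix (Fin 4) (Fin 4) ℂ) =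
    !![0, 0, 0, 0; 0, 0, 0, 0; 0, 0, -2 * (m : ℂ), 0; 0, 0, 0, -2 * (m : ℂ)] := by
  rw [sl_restMomentum, real_smul_one_eq]
  ext i j
  fin_cases i <;> fin_cases j <;> simp [γ0, Complex.real_smul] <;> ring

/-- **«(p̂ − m)ψ₁ = 0» has the nonzero solution ψ₁ = e₀** at the rest-frame point.
[cite: Volkov2020, §2.1 «(p̂ − q̂/2 − m)ψ₁ = … = 0» (journal p.6; arXiv:1912.04885v4 tex l.139); proof of Lemma 3.8 «(m − p̂₁)ψ₁ = 0» (p.15; tex l.497)] -/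
theorem spinor_cond₁ (m : ℝ) :
    (sl diracGamma (restMomentum m) - m • (1 : Matrix (Fin 4) (Fin 4) ℂ)) *ᵥ (Pi.single 0 1 : Fin 4 → ℂ) = 0 := by
  rw [sl_sub_eq]
  ext i
  fin_cases i <;> simp [Matrix.mulVec, dotProduct, Pi.single_apply]

/-- **«ψ̄₂(p̂ − m) = 0» has the nonzero solution ψ̄₂ = e₀** (row vector) at the rest-frame point.
[cite: Volkov2020, §2.1 «ψ̄₂(p̂ + q̂/2 − m) = 0» (journal p.6; arXiv:1912.04885v4 tex l.139); proof of Lemma 3.8 «ψ̄₂(m − p̂₂) = 0» (p.15; tex l.497)] -/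
theorem spinor_cond₂ (m : ℝ) :
    Matrix.vecMul (Pi.single 0 1 : Fin 4 → ℂ) (sl diracGamma (restMomentum m) - m • (1 : Matrix (Fin 4) (Fin 4) ℂ)) = 0 := by
  rw [sl_sub_eq]
  ext j
  fin_cases j <;> simp [Matrix.vecMul, dotProduct, Pi.single_apply]

/-- The functional X ↦ Re(ψ̄₂Xψ₁) = Re X₀₀ for ψ₁ = ψ̄₂ = e₀, ℝ-linear.
[cite: Volkov2020, proof of Lemma 3.8 «we consider only expressions of the form ψ̄₂Γ(p₁,p₂)ψ₁» (journal p.15; arXiv:1912.04885v4 tex l.497)] -/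
def entryRe : Matrix (Fin 4) (Fin 4) ℂ →ₗ[ℝ] ℝ where
  toFun X := (X 0 0).re
  map_add' X Y := by simp
  map_smul' r X := by simp

/-- entryRe X = Re X₀₀. [cite: Volkov2020, proof of Lemma 3.8 (journal p.15; arXiv:1912.04885v4 tex l.497)] -/
theorem entryRe_apply (X : Matrix (Fin 4) (Fin 4) ℂ) : entryRe X = (X 0 0).re := rfl

/-- **The functional kills U(p̂ − m)** («(m − p̂₁)ψ₁ = 0»: the pairing ψ̄₂·U(p̂ − m)·ψ₁ vanishes).
[cite: Volkov2020, proof of Lemma 3.8, first sentence (journal p.15; arXiv:1912.04885v4 tex l.497–499)] -/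
theorem entryRe_kill_right (m : ℝ) (U : Matrix (Fin 4) (Fin 4) ℂ) :
    entryRe (U * (sl diracGamma (restMomentum m) - m • (1 : Matrix (Fin 4) (Fin 4) ℂ))) = 0 := by
  rw [entryRe_apply, sl_sub_eq, Matrix.mul_apply]
  simp [Fin.sum_univ_four]

/-- **The functional kills (p̂ − m)V** («ψ̄₂(m − p̂₂) = 0»).
[cite: Volkov2020, proof of Lemma 3.8, first sentence (journal p.15; arXiv:1912.04885v4 tex l.497–499)] -/
theorem entryRe_kill_left (m : ℝ) (V : Matrix (Fin 4) (Fin 4) ℂ) :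
    entryRe ((sl diracGamma (restMomentum m) - m • (1 : Matrix (Fin 4) (Fin 4) ℂ)) * V) = 0 := by
  rw [entryRe_apply, sl_sub_eq, Matrix.mul_apply]
  simp [Fin.sum_univ_four]

/-- **The functional kills γ_k for the spatial indices** («𝒫γ_μ = 0» is met by this witness for μ = 1, 2, 3).
[cite: Volkov2020, §2.2.2 «𝒫γ_μ = 0» (journal p.9; arXiv:1912.04885v4 tex l.271–273)] -/
theorem entryRe_gamma_spatial (k : Fin 4) (hk : k ≠ 0) : entryRe (diracGamma k) = 0 := by
  fin_cases k
  · exact absurd rfl hk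
  all_goals simp [entryRe_apply, diracGamma, γ1, γ2, γ3]

/-- **The functional is bounded with N = 1**: |entryRe X| ≤ 1·‖X‖.
[cite: Volkov2020, Lemma 3.9 «C is some constant …» (journal p.16; arXiv:1912.04885v4 tex l.530) — the model's N] -/
theorem abs_entryRe_le (X : Matrix (Fin 4) (Fin 4) ℂ) : |entryRe X| ≤ 1 * ‖X‖ := by
  rw [entryRe_apply, one_mul]
  exact (Complex.abs_re_le_norm _).trans (norm_entry_le X 0 0)

/-- entryRe 1 = 1 (the functional is nonzero). [cite: Volkov2020, proof of Lemma 3.8 (journal p.15; arXiv:1912.04885v4 tex l.497)] -/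
theorem entryRe_one : entryRe (1 : Matrix (Fin 4) (Fin 4) ℂ) = 1 := by
  simp [entryRe_apply]

/-- **B.37's on-shell relation is NON-TRIVIAL in the Dirac model**: at the printed point q = 0 (p₁ = p₂ = p = (m, 0, 0, 0)), 1 ≉ 0, for
every m. [cite: Volkov2020, proof of Lemma 3.8, first sentence (journal p.15; arXiv:1912.04885v4 tex l.497–499)] -/
theorem not_onShellEq_one_zero (m : ℝ) :
    ¬ OnShellEq diracGamma m (restMomentum m) (restMomentum m) (1 : Matrix (Fin 4) (Fin 4) ℂ) 0 := by
  rintro ⟨U, V, hUV⟩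
  have h := congrArg entryRe hUV
  rw [sub_zero, entryRe_one, map_add, entryRe_kill_right, entryRe_kill_left, add_zero] at h
  exact one_ne_zero h

end Normed

end DiracModel

end Literature.MathematicalPhysics.QuantumFieldTheory.Volkov2020

namespace Literature.MathematicalPhysics.QuantumFieldTheory.Volkov2020

namespace DiracModel

open AppendixNumerators ProjectorVanishing Matrix Complex

/-! ## §4 (r2) The pipeline closed in the model: B.47's `abs_projector_le` applied to the Dirac matrices, the rest-frame point and `entryRe` -/

section Pipeline

attribute [local instance] Matrix.linftyOpNormedRing Matrix.linftyOpNormedAlgebra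

/-- The model context at the printed point {p² = m², q = 0}: γ = the Dirac matrices, mass m, p₁ = p₂ = (m, 0, 0, 0), free index μ = k.
[cite: Volkov2020, §2.2.2 «𝒫[Γ(p,q)] is determined by Γ(p,q) at {p² = m², q = 0}» (journal p.9; arXiv:1912.04885v4 tex l.259)] -/
noncomputable def modelCtx (m : ℝ) (k : Fin 4) : Ctx (Matrix (Fin 4) (Fin 4) ℂ) :=
  { γ := diracGamma, m := m, p₁ := restMomentum m, p₂ := restMomentum m, μ := k }

/-- **B.47's (3.11)-shape bound HOLDS NON-VACUOUSLY IN THE PHYSICAL MODEL**: for the one-photon-exchange numerator shape γ^ν(m + Q̂′₂)γ_k(m + Q̂′₁)γ_ν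
(name ν = 0 on both sides of γ_k) with Dirac matrices, m ≠ 0, the rest-frame point, any slot vectors with l1(Q′ − p) ≤ K·B (0 ≤ B ≤ 1) and the
functional Re(ψ̄₂·ψ₁) = `entryRe` (N = 1): |entryRe X| ≤ assemblyConst·B.
[cite: Volkov2020, Lemma 3.9 eq. (3.11) (journal p.16; arXiv:1912.04885v4 tex l.525–531)] -/
theorem model_abs_projector_le (m : ℝ) (hm : m ≠ 0) (k : Fin 4) (hk : k ≠ 0) {K B : ℝ} (hK : 0 ≤ K) (hB0 : 0 ≤ B) (hB1 : B ≤ 1)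
    (v w : Fin 4 → ℝ) (hv : l1 (v - restMomentum m) ≤ K * B) (hw : l1 (w - restMomentum m) ≤ K * B) :
    |entryRe (E (modelCtx m k) [(0 : Fin 1)] (wordQ [((0 : Fin 1), v)] [((0 : Fin 1), w)]))| ≤
      1 * (assemblyConst (modelCtx m k) K 1 1 1 * B) :=
  abs_projector_le (modelCtx m k) isDirac_diracGamma hm (dot_restMomentum m) (dot_restMomentum m)
    [((0 : Fin 1), v)] [((0 : Fin 1), w)] [0] (List.nodup_singleton _) (fun i => by fin_cases i; simp)
    (fun i hi => by simp only [List.map_cons, List.map_nil, List.singleton_append, List.mem_cons, List.not_mem_nil, or_false] at hi ⊢;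
                    fin_cases i; simp) hK hB0 hB1
    (fun iq hiq => by simp only [List.mem_singleton] at hiq; subst hiq; exact hv)
    (fun jq hjq => by simp only [List.mem_singleton] at hjq; subst hjq; exact hw)
    entryRe (entryRe_kill_right m) (entryRe_kill_left m) (entryRe_gamma_spatial k hk) abs_entryRe_le

end Pipeline

end DiracModel

end Literature.MathematicalPhysics.QuantumFieldTheory.Volkov2020
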